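import Summits.BirchSwinnertonDyer.BirchSwinnertonDyer.Theorems.AdditiveBranchIMCGordTwoRankOneHeegnerKolyvaginStepL
import Summits.BirchSwinnertonDyer.BirchSwinnertonDyer.Theorems.AdditiveBranchIMCGordTwoRankOneHeegnerKolyvaginUpper
import Literature.NumberTheory.EllipticCurves.BSDSelmerPConverseSerreProofs
import HarnessLib

/-!
# Route `AdditiveBranchIMC` (rung K1), crux `GordTwoRankOne` (item 19358): the Heegner–Kolyvagin road,
# Part 11 — CLASS LEVEL `BSD(E,p)` (BOTH halves) on the surjective rows of cell (G-ord, `e = 2`) at `p ≥ 11`,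
# `p ∤ ∏c_ℓ(E)`, from PUBLISHED facts + STEP L′ + the rank-zero LOWER half at the Friedberg–Hoffstein twists
# (cell `bsd-addord`, lane `bsd-addord-k1-c3x`, gen 2; `--supports` only)

HONEST FRAMING. THEOREMS ONLY: no definition, no new named fact, no `sorry`; nothing is booked; the crux
stays OPEN at class level; «BSD is not proved by any of this». On lane B's road (Jetchev–Skinner–Wan 2017
§7.4 shape AT AN ADDITIVE PRIME) the two halves of `BSD(E,p)` for a rank-one `E` at an additive potentially
good ordinary `p` (`e = 2`) come from DIFFERENT typed inputs and NO rider: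
* LOWER (`ord_p #Ш(E)_an ≤ ord_p #Ш(E)`, the crux's conclusion) ⟸ PUB + STEP L′ (Part 8,
  `missingLowerBoundAt_rankOne_additive_of_adjustedIndexBound`);
* UPPER (`ord_p #Ш(E) ≤ ord_p #Ш(E)_an`) ⟸ PUB (Kolyvagin 1990 Thm. A, `hB`) + the rank-ZERO LOWER half at
  the twist `E^{d_K}` — crux `GordTwoRankZeroOffCaseOne` (item 19357)'s conclusion at `(Wd, p)` — when
  `p ≥ 5`, `ρ̄_{E,p}` onto, `p ∤ ∏c_ℓ(E)` and the datum is Manin-good (Part 6,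
  `missingUpperBoundAt_rankOne_additive_of_twistLower`).
THIS FILE assembles them at CLASS LEVEL, choosing the auxiliary field by Friedberg–Hoffstein (`hFH`), the
Manin-good datum by Edixhoven 1991 Thm. 3 at `p ≥ 11` (Part 2, `exists_maninDatum_of_cellGordTwo`), the
minimal twist model by Néron, and tower-surjectivity from `surj(p)` by Serre (tree theorem
`serre_hasSurjectiveModNGaloisRep_pow_holds`):

  `cellGordTwo_bsdp_rankOne_of_surj_of_adjustedIndexBound_of_twistLower` :
  [PUB: hGZ hKo hB hKatoT hGZK hmod hnf hmodP hFH hEdxK hNS] → STEP L′ (∀-form, OPEN) →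
  LOWER at the Friedberg–Hoffstein twists of the rows (19357's conclusion there, OPEN) →
  ∀ W p, r_an = 1 → CellGordTwo W p → 11 ≤ p → surj(p) → p ∤ ∏c_ℓ(E) → `BSDp W p`.

WHY IT MATTERS (README §2 edges): on these rows the programme's map reaches B6 r1 through K1 + K1′ (analytic
`p`-adic Gross–Zagier at an unstable prime) + C1 (Schneider certificate per pair). On lane B's road K1′ and
C1 BOTH DISAPPEAR: `BSD(E,p)` ⟸ STEP L′ (= the χ_K-branch anticyclotomic Selmer-large input, Part 9's memo)
+ K1's rank-zero object at the twist; no `p`-adic height, no `p`-adic `L`-function, no Λ-adic branch object.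
The price is the locus: `p ≥ 11` (Manin; at `p ∈ {5,7}` a Manin-unit datum per optimal curve), `ρ̄_{E,p}` onto,
`p ∤ ∏c_ℓ(E)` (where Kolyvagin's bound is sharp). Nothing booked; both inputs OPEN.

References: [JetchevSkinnerWan2017] §7.4.1–§7.4.3 (pp. 29–31); [KolyvaginEulerSystems1990] Thm. A;
[McCallumLMS1991] §1; [EdixhovenManin1991] Thm. 3; [SerreAbelianLadic1968] IV-23 Lemma 3;
[Kato2004Asterisque] Thm. 14.5 (3); [Miller2011LMS] Def. 1.1.
-/

set_option autoImplicit false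
set_option linter.dupNamespace false
noncomputable section

open scoped Classical NumberField
open WeierstrassCurve NumberField IsDedekindDomain
  Literature.NumberTheory.EllipticCurves Literature.NumberTheory.EllipticCurves.ModularForms
  Literature.NumberTheory.EllipticCurves.Rank1Residual
  Literature.NumberTheory.EllipticCurves.Rank1Residual.Typed
  Summit.BirchSwinnertonDyer.Rank1Residual
  Summit.BirchSwinnertonDyer.Rank1Residual.Additive
  Summit.BirchSwinnertonDyer.Rank1Residual.X11b
  Summit.BirchSwinnertonDyer.Rank1Residual.GaloisImage
  Literature.NumberTheory.Automorphic

namespace Summit.BirchSwinnertonDyer.BirchSwinnertonDyer.Theorems.AdditiveBranchIMCGordTwoRankOne.HeegnerKolyvagin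

/-! ### §22 Class level: `BSD(E,p)` on the surjective rows of the cell at `p ≥ 11`, `p ∤ ∏c_ℓ(E)` -/

/-- **`BSD(E,p)` (both halves) on lane B's road, CLASS LEVEL.** For every globally minimal `E/ℚ` with
`ord_{s=1} L(E,s) = 1` and every pair of cell (G-ord, `e = 2`) with `p ≥ 11`, `ρ̄_{E,p}` onto and
`p ∤ ∏c_ℓ(E)`: `BSDp W p`, from the PUBLISHED binders `hGZ` (Gross–Zagier), `hKo` (Kolyvagin, qualitative),
`hB` (Kolyvagin 1990 Thm. A: `ord_p #Ш(E/K) ≤ 2·ord_p[E(K):ℤP]`), `hKatoT` (Kato 2004 Thm. 14.5 (3),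
Tamagawa-exact, for the rank-0 twist), `hGZK`, `hmod`, `hnf`, `hmodP`, `hFH` (Friedberg–Hoffstein), `hEdxK` +
`hNS` (Edixhoven 1991 Thm. 3: a Manin-good datum at `p ≥ 11` on the cell), and TWO TYPED OPEN INPUTS:
`hL'` — STEP L′ at the Heegner data of the tower-surjective rank-one rows (the road's residual, Part 8; implied
by BSD with equality, Part 9); `hTwL` — the rank-ZERO LOWER half `Typed.MissingLowerBoundAt Wd p` at every
globally minimal model `Wd` of the twist `E^{d_K}` by a Heegner field `K` of the conductor with
`L(E^{d_K},1) ≠ 0` (crux 19357's conclusion at `(Wd, p)`: `Wd` is again additive potentially good at `p`,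
Part 1 `addv_twist_of_heegner`). LOWER by Part 8, UPPER by Part 6, glued by x11b's `bsdp_of_halves`;
tower-surjectivity from `surj(p)` by Serre (`p ≥ 11 ≥ 5`). No `p`-adic height, no `p`-adic `L`-function, no
Schneider, no A′. Nothing is booked; both inputs are OPEN. [cite: JetchevSkinnerWan2017, §7.4.1–§7.4.3 (pp. 29–31)]
[cite: McCallumLMS1991, §1 Theorem (Kolyvagin), p. 296] [cite: EdixhovenManin1991, Thm. 3]
[cite: SerreAbelianLadic1968, Ch. IV §3.4, Lemma 3 (IV-23)] [cite: Miller2011LMS, §1 and Def. 1.1] -/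
theorem cellGordTwo_bsdp_rankOne_of_surj_of_adjustedIndexBound_of_twistLower
    -- published inputs (named facts of the tree)
    (hGZ : ∀ (N : ℕ) [NeZero N] (W : WeierstrassCurve ℚ) (K : Type) [Field K] [NumberField K],
      gross_zagier N W K)
    (hKo : ∀ (N : ℕ) [NeZero N] (W : WeierstrassCurve ℚ) (K : Type) [Field K] [NumberField K],
      kolyvagin N W K)
    (hB : ∀ (N : ℕ) [NeZero N] (W : WeierstrassCurve ℚ) (K : Type) [Field K] [NumberField K],
      Kolyvagin1990_padicValNat_card_sha_le N W K)
    (hKatoT : Kato2004.rankZero_padicValNat_sha_add_padicValNat_tamagawa_le_of_additive_potGood_of_imageContainsSL2)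
    (hGZK : rank_eq_analyticRank_of_analyticRank_le_one) (hmod : hasEntireLFunction_rat)
    (hnf : exists_isNewformOf) (hmodP : nonempty_modularParametrizationData)
    (hFH : friedbergHoffstein_exists_heegnerField_split_twist_ne_zero)
    (hEdxK : edixhoven_not_dvd_maninConstant_of_kodairaSymbol_ne)
    (hNS : integral_neronScaling_of_isGloballyMinimal)
    -- typed OPEN input 1: STEP L′ at the Heegner data of the tower-surjective rank-one rows of the cell
    (hL' : ∀ (W : WeierstrassCurve ℚ) [W.IsElliptic] [W.IsGloballyMinimal] (p : ℕ) [Fact p.Prime]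
      (N : ℕ) [NeZero N] (K : Type) [Field K] [NumberField K]
      (Dt : ModularParametrizationData W N) (H : HeegnerDatum N (NumberField.discr K)) (ι : K →+* ℂ)
      (P : (W.baseChange K).toAffine.Point)
      (Wd : WeierstrassCurve ℚ) [Wd.IsElliptic] [Wd.IsGloballyMinimal] (Cd : VariableChange ℚ),
      W.analyticRank = 1 → N10.CellGordTwo W p → (∀ n : ℕ, W.HasSurjectiveModNGaloisRep (p ^ n : ℕ)) →
      W.conductorNorm ℤ = N → IsImaginaryQuadratic K → SatisfiesHeegnerHypothesis N K →
      WeierstrassCurve.Affine.Point.map ι.toRatAlgHom P = heegnerPointComplex Dt H →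
      Cd • W.quadraticTwist (NumberField.discr K : ℚ) = Wd →
      Finite (W.baseChange K).sha →
      (2 * padicValNat p (AddSubgroup.zmultiples P).index : ℤ) ≤
        padicValNat p (W.baseChange K).shaOrder + padicValNat p W.tamagawaProduct +
          padicValNat p Wd.tamagawaProduct + 2 * padicValRat p (Dt.c : ℚ))
    -- typed OPEN input 2: the rank-zero LOWER half at the Heegner-field twists of those rows (19357 there)
    (hTwL : ∀ (W : WeierstrassCurve ℚ) [W.IsElliptic] [W.IsGloballyMinimal] (p : ℕ) [Fact p.Prime]
      (K : Type) [Field K] [NumberField K]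
      (Wd : WeierstrassCurve ℚ) [Wd.IsElliptic] [Wd.IsGloballyMinimal] (Cd : VariableChange ℚ),
      W.analyticRank = 1 → N10.CellGordTwo W p → (∀ n : ℕ, W.HasSurjectiveModNGaloisRep (p ^ n : ℕ)) →
      IsImaginaryQuadratic K → SatisfiesHeegnerHypothesis (W.conductorNorm ℤ) K →
      (W.quadraticTwist (NumberField.discr K : ℚ)).entireLFunction 1 ≠ 0 →
      Cd • W.quadraticTwist (NumberField.discr K : ℚ) = Wd → Typed.MissingLowerBoundAt Wd p) :
    ∀ (W : WeierstrassCurve ℚ) [W.IsElliptic] [W.IsGloballyMinimal] (p : ℕ) [Fact p.Prime],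
      W.analyticRank = 1 → N10.CellGordTwo W p → 11 ≤ p → W.HasSurjectiveModNGaloisRep p →
      ¬ p ∣ W.tamagawaProduct → BSDp W p := by
  intro W _ _ p _ hr hc2 hp11 hsurj1 htam0
  have hp : p.Prime := Fact.out
  have hp5 : 5 ≤ p := le_trans (by norm_num) hp11
  have hp7 : 7 < p := lt_of_lt_of_le (by norm_num) hp11
  -- tower-surjectivity from `surj(p)` (Serre, `p ≥ 5`)
  have hsurj : ∀ n : ℕ, W.HasSurjectiveModNGaloisRep (p ^ n : ℕ) :=
    serre_hasSurjectiveModNGaloisRep_pow_holds W p hp5 hsurj1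
  obtain ⟨hp2, hadd, hG, he⟩ := hc2
  haveI : NeZero (W.conductorNorm ℤ) := ⟨(W.conductorNorm_pos_holds).ne'⟩
  have hj : 0 ≤ padicValRat p W.j := not_lt.mp (N10.not_potMult_of_typeGOrd W p hp2 hadd hG)
  have hirr : W.HasIrreducibleModPGaloisRep p := by
    haveI : NeZero (p : ℚ) := ⟨by exact_mod_cast hp.ne_zero⟩
    exact hasIrreducibleModPGaloisRep_of_hasSurjectiveModNGaloisRep W p hsurj1
  -- the sign of the functional equation is `−1`
  have hw : W.rootNumber = -1 := by
    rw [WeierstrassCurve.rootNumber_eq_neg_one_pow_analyticRank_of_exists_isNewformOf hnf W, hr]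
    norm_num
  -- the auxiliary field (Friedberg–Hoffstein): every `ℓ ∣ N` split, `|d_K| > 4`, `L(E^{d_K},1) ≠ 0`
  obtain ⟨K, _, _, hK, hdisc, hHN, -, hLt⟩ := hFH W hw p hp 4
  have hμ : ¬ p ∣ Units.torsionOrder K := by
    haveI : IsTotallyComplex K := hK.2
    have hneg : NumberField.discr K < 0 := discr_neg_of_finrank_eq_two K hK.1
    have habs : ((NumberField.discr K).natAbs : ℤ) = -NumberField.discr K :=
      Int.ofNat_natAbs_of_nonpos hneg.le
    have h4 : NumberField.discr K < -4 := by
      have : (4 : ℤ) < ((NumberField.discr K).natAbs : ℤ) := by exact_mod_cast hdisc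
      omega
    rw [Literature.NumberTheory.DiophantineGeometry.torsionOrder_eq_two_of_discr_lt hK.1 h4]
    intro h2
    have := Nat.le_of_dvd two_pos h2
    have h2le : 2 ≤ p := hp.two_le
    omega
  -- the Manin-good Heegner datum (Edixhoven 1991 Thm. 3 at `p ≥ 11`)
  obtain ⟨Dt, H, ι, P, hP, hc⟩ :=
    exists_maninDatum_of_cellGordTwo hnf hmodP hEdxK hNS W p K ⟨hp2, hadd, hG, he⟩ hp7 hirr hK hHN
  -- a globally minimal model of the twist (Néron)
  have hD0 : (NumberField.discr K : ℚ) ≠ 0 := by exact_mod_cast NumberField.discr_ne_zero K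
  haveI hEt : (W.quadraticTwist (NumberField.discr K : ℚ)).IsElliptic :=
    W.isElliptic_quadraticTwist hD0
  obtain ⟨Cd, hCd⟩ := hasGlobalMinimalModel_rat_holds (W.quadraticTwist (NumberField.discr K : ℚ))
  haveI : (Cd • W.quadraticTwist (NumberField.discr K : ℚ)).IsGloballyMinimal := hCd
  have hWd : Cd • W.quadraticTwist (NumberField.discr K : ℚ) =
      Cd • W.quadraticTwist (NumberField.discr K : ℚ) := rfl
  -- the twist's rank-zero lower half at this model (typed input 2)
  have htwL : Typed.MissingLowerBoundAt (Cd • W.quadraticTwist (NumberField.discr K : ℚ)) p :=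
    hTwL W p K (Cd • W.quadraticTwist (NumberField.discr K : ℚ)) Cd hr ⟨hp2, hadd, hG, he⟩ hsurj hK hHN
      hLt hWd
  -- LOWER (Part 8) and UPPER (Part 6), glued
  exact bsdp_of_halves hGZK W p (le_of_eq hr)
    (missingLowerBoundAt_rankOne_additive_of_adjustedIndexBound W p K Dt H ι P (hGZ _ W K) (hKo _ W K)
      hKatoT hGZK hmod hr hp2 hadd hj hsurj hK hHN hP hμ hLt
      (Cd • W.quadraticTwist (NumberField.discr K : ℚ)) Cd hWd
      (hL' W p _ K Dt H ι P (Cd • W.quadraticTwist (NumberField.discr K : ℚ)) Cd hr ⟨hp2, hadd, hG, he⟩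
        hsurj rfl hK hHN hP hWd))
    (missingUpperBoundAt_rankOne_additive_of_twistLower W p K Dt H ι P (hGZ _ W K) (hKo _ W K) (hB _ W K)
      hGZK hmod hr hp5 hsurj1 htam0 hK hHN hP hc hμ hLt
      (Cd • W.quadraticTwist (NumberField.discr K : ℚ)) Cd hWd hadd.1 htwL)

/-- **The same with the crux BY NAME as the LOWER input.** `GordTwoRankOne` (item 19358, taken as a
HYPOTHESIS) + the rank-zero lower half at the Heegner-field twists (`hTwL`, 19357's conclusion there) +
PUBLISHED facts ⟹ `BSDp W p` on every rank-one pair of the cell with `p ≥ 11`, `ρ̄_{E,p}` onto,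
`p ∤ ∏c_ℓ(E)`: the route's two K1 lower-half objects give FULL `BSD(E,p)` on these rows, Schneider-free and
without any `p`-adic Gross–Zagier formula. (The STEP L′ input of the previous theorem is itself implied by
the crux and `hTwL`, Part 9 `adjustedIndexBound_of_gordTwoRankOne_of_twistLower`; here the lower half is read
off the crux directly.) Nothing booked; an implication between OPEN statements and PUBLISHED facts.
[cite: JetchevSkinnerWan2017, §7.4.2–§7.4.3 (p. 31)] [cite: McCallumLMS1991, §1 Theorem (Kolyvagin), p. 296]
[cite: EdixhovenManin1991, Thm. 3] [cite: Miller2011LMS, §1 and Def. 1.1] -/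
theorem cellGordTwo_bsdp_rankOne_of_surj_of_gordTwoRankOne_of_twistLower
    (hcrux : Summit.BirchSwinnertonDyer.BirchSwinnertonDyer.Theses.AdditiveBranchIMC.GordTwoRankOne)
    (hGZ : ∀ (N : ℕ) [NeZero N] (W : WeierstrassCurve ℚ) (K : Type) [Field K] [NumberField K],
      gross_zagier N W K)
    (hKo : ∀ (N : ℕ) [NeZero N] (W : WeierstrassCurve ℚ) (K : Type) [Field K] [NumberField K],
      kolyvagin N W K)
    (hB : ∀ (N : ℕ) [NeZero N] (W : WeierstrassCurve ℚ) (K : Type) [Field K] [NumberField K],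
      Kolyvagin1990_padicValNat_card_sha_le N W K)
    (hGZK : rank_eq_analyticRank_of_analyticRank_le_one) (hmod : hasEntireLFunction_rat)
    (hnf : exists_isNewformOf) (hmodP : nonempty_modularParametrizationData)
    (hFH : friedbergHoffstein_exists_heegnerField_split_twist_ne_zero)
    (hEdxK : edixhoven_not_dvd_maninConstant_of_kodairaSymbol_ne)
    (hNS : integral_neronScaling_of_isGloballyMinimal)
    (hTwL : ∀ (W : WeierstrassCurve ℚ) [W.IsElliptic] [W.IsGloballyMinimal] (p : ℕ) [Fact p.Prime]
      (K : Type) [Field K] [NumberField K]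
      (Wd : WeierstrassCurve ℚ) [Wd.IsElliptic] [Wd.IsGloballyMinimal] (Cd : VariableChange ℚ),
      W.analyticRank = 1 → N10.CellGordTwo W p → (∀ n : ℕ, W.HasSurjectiveModNGaloisRep (p ^ n : ℕ)) →
      IsImaginaryQuadratic K → SatisfiesHeegnerHypothesis (W.conductorNorm ℤ) K →
      (W.quadraticTwist (NumberField.discr K : ℚ)).entireLFunction 1 ≠ 0 →
      Cd • W.quadraticTwist (NumberField.discr K : ℚ) = Wd → Typed.MissingLowerBoundAt Wd p) :
    ∀ (W : WeierstrassCurve ℚ) [W.IsElliptic] [W.IsGloballyMinimal] (p : ℕ) [Fact p.Prime],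
      W.analyticRank = 1 → N10.CellGordTwo W p → 11 ≤ p → W.HasSurjectiveModNGaloisRep p →
      ¬ p ∣ W.tamagawaProduct → BSDp W p := by
  intro W _ _ p _ hr hc2 hp11 hsurj1 htam0
  have hp : p.Prime := Fact.out
  have hp5 : 5 ≤ p := le_trans (by norm_num) hp11
  have hp7 : 7 < p := lt_of_lt_of_le (by norm_num) hp11
  have hsurj : ∀ n : ℕ, W.HasSurjectiveModNGaloisRep (p ^ n : ℕ) :=
    serre_hasSurjectiveModNGaloisRep_pow_holds W p hp5 hsurj1
  have hlow : Typed.MissingLowerBoundAt W p := hcrux W p hr hc2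
  obtain ⟨hp2, hadd, hG, he⟩ := hc2
  haveI : NeZero (W.conductorNorm ℤ) := ⟨(W.conductorNorm_pos_holds).ne'⟩
  have hirr : W.HasIrreducibleModPGaloisRep p := by
    haveI : NeZero (p : ℚ) := ⟨by exact_mod_cast hp.ne_zero⟩
    exact hasIrreducibleModPGaloisRep_of_hasSurjectiveModNGaloisRep W p hsurj1
  have hw : W.rootNumber = -1 := by
    rw [WeierstrassCurve.rootNumber_eq_neg_one_pow_analyticRank_of_exists_isNewformOf hnf W, hr]
    norm_num
  obtain ⟨K, _, _, hK, hdisc, hHN, -, hLt⟩ := hFH W hw p hp 4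
  have hμ : ¬ p ∣ Units.torsionOrder K := by
    haveI : IsTotallyComplex K := hK.2
    have hneg : NumberField.discr K < 0 := discr_neg_of_finrank_eq_two K hK.1
    have habs : ((NumberField.discr K).natAbs : ℤ) = -NumberField.discr K :=
      Int.ofNat_natAbs_of_nonpos hneg.le
    have h4 : NumberField.discr K < -4 := by
      have : (4 : ℤ) < ((NumberField.discr K).natAbs : ℤ) := by exact_mod_cast hdisc
      omega
    rw [Literature.NumberTheory.DiophantineGeometry.torsionOrder_eq_two_of_discr_lt hK.1 h4]
    intro h2
    have := Nat.le_of_dvd two_pos h2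
    have h2le : 2 ≤ p := hp.two_le
    omega
  obtain ⟨Dt, H, ι, P, hP, hc⟩ :=
    exists_maninDatum_of_cellGordTwo hnf hmodP hEdxK hNS W p K ⟨hp2, hadd, hG, he⟩ hp7 hirr hK hHN
  have hD0 : (NumberField.discr K : ℚ) ≠ 0 := by exact_mod_cast NumberField.discr_ne_zero K
  haveI hEt : (W.quadraticTwist (NumberField.discr K : ℚ)).IsElliptic :=
    W.isElliptic_quadraticTwist hD0
  obtain ⟨Cd, hCd⟩ := hasGlobalMinimalModel_rat_holds (W.quadraticTwist (NumberField.discr K : ℚ))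
  haveI : (Cd • W.quadraticTwist (NumberField.discr K : ℚ)).IsGloballyMinimal := hCd
  have hWd : Cd • W.quadraticTwist (NumberField.discr K : ℚ) =
      Cd • W.quadraticTwist (NumberField.discr K : ℚ) := rfl
  have htwL : Typed.MissingLowerBoundAt (Cd • W.quadraticTwist (NumberField.discr K : ℚ)) p :=
    hTwL W p K (Cd • W.quadraticTwist (NumberField.discr K : ℚ)) Cd hr ⟨hp2, hadd, hG, he⟩ hsurj hK hHN
      hLt hWd
  exact bsdp_of_halves hGZK W p (le_of_eq hr) hlow
    (missingUpperBoundAt_rankOne_additive_of_twistLower W p K Dt H ι P (hGZ _ W K) (hKo _ W K) (hB _ W K)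
      hGZK hmod hr hp5 hsurj1 htam0 hK hHN hP hc hμ hLt
      (Cd • W.quadraticTwist (NumberField.discr K : ℚ)) Cd hWd hadd.1 htwL)

end Summit.BirchSwinnertonDyer.BirchSwinnertonDyer.Theorems.AdditiveBranchIMCGordTwoRankOne.HeegnerKolyvagin

end
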